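import Literature.NumberTheory.Transcendental.TwoCurveEngine
import Literature.NumberTheory.Transcendental.TwoCurveThetaModel
import Literature.NumberTheory.Transcendental.TwoCurveThetaCosets
import Literature.NumberTheory.Transcendental.ThetaSubgroupClassification
import HarnessLib

/-!
# Orbit closures in the two-lattice theta model; the dictionary with analytic group models

Topic `Literature/NumberTheory/Transcendental`; unit
`provefact-Literature.NumberTheory.Transcendental.H-a66b67e3eb` (fact
`Literature.NumberTheory.Transcendental.HuberWustholzTwoCurvePeriods`). It introduces NO named fact.
Two-lattice counterpart (stage P6a of the port of the discharge programme of Philippon's zero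
estimate) of the orbit-closure section of `ThetaSubgroupHull.lean` and of the model-independent
steps of `ThetaSubgroupClassification.lean` (the dictionary `M.F ↔ thetaEval`, closedness through
`thetaEval`, automorphy, and Step B1), for the theta model of `M = 𝔾ₘ^β × P` with blockwise
lattices `Λ_b = GaGmEE.lat L L' b`.

## What is proved here (everything; no `sorry`, no new `def … : Prop`)

* `slope`, `theta_add_of_z`, `orbitPoly`, `thetaEval_add_of_z`, `thetaEval_add_natMul` — along a
  `z'`-free translation `F_P` is an exponential polynomial;
* **periodicity lemmas** `thetaEval_eq_zero_of_forall_natMul` (Baker's generalised Vandermonde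
  lemma, reused) and `thetaEval_eq_zero_of_forall_natMul_lattice` (lattice `E`-coordinates,
  blockwise periods `ω_i(Λ_b)` and quasi-periods `η_i(Λ_b)`; `coords_lattice_mem_ker`,
  `thetaEval_add_ker_eq_zero_iff`);
* **Artin move** `thetaEval_eq_zero_of_forall_mem_addSubgroup` (independence of characters);
* for an analytic group model `M` on `Lie M_ℂ` whose coordinates are the theta functions up to an
  indexing equivalence (`hΘ`): `F_rename`, `F_eq_thetaEval`, `thetaEval_eq_zero_of_mem_zeroSet`,
  `mem_of_isClosedG`, `add_mem_of_isClosedG_of_mem_ker`, `ker_subset_of_isClosedG`, and Step B1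
  `choose_le_hilbC_vanishing_tangent`, **`finrank_tangent_succ_le_coneDim`**
  (`coneDim (Lie G') ≥ dim G' + 1`, from `TwoCurveThetaCosets.exists_linearIndependent_thetaEval_coset`)
  for every datum `K : GaGmE.Std.SubgroupDataC β (γ ⊕ γ') δ κM`;
* **assembly** `classification_of_hull` (Steps A, B0–B2 verbatim from the one-factor file): the
  classification of the closed irreducible subgroups (hypothesis `hCL` of
  `TwoCurveThetaModel.philippon_shape_of_classification'`) from a hull map `hull` with
  `𝔥 ≤ Lie(hull 𝔥)`, the hull property `hHull` (forms vanishing on `𝔥` vanish on `Lie(hull 𝔥)`)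
  and the closure property `hB3` (`Z(𝔍(𝔥)) ⊆ exp⁻¹(hull 𝔥)`); and **`philippon_of_hull`** —
  Philippon's zero estimate for the two-lattice theta model in the shape of `philippon1986_std`
  from such a hull map alone (model `thetaModel (hardData)`, `Θ_thetaModel_symm`).

The hull map itself for several elliptic factors (which needs `End(E) = End(E') = ℤ` and
`Hom(E, E') = 0`) is not in this file.

## References

* Yu. V. Nesterenko, P. Philippon (eds.), *Introduction to Algebraic Independence Theory*,
  LNM 1752, Springer 2001, Ch. 11 (D. Roy), Thm. 4.1, Prop. 2.3, Prop. 3.8. [NesterenkoPhilippon2001]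
* A. Baker, *Transcendental Number Theory*, CUP 1975, Ch. 3 §2, Lemma 3. [BakerTNT1975]
* A. Huber, G. Wüstholz, *Transcendence and Linear Relations of 1-Periods*, CUP 2022, Thm. 15.3.
  [HuberWustholz2022]
-/

noncomputable section

open Complex
open scoped PeriodPair

namespace Literature.NumberTheory.Transcendental

namespace GaGmEE

namespace Std

open GaGmE (Kbar)
open GaGmE.Std (iy iz is coords coords_iy coords_iz coords_is ThetaIdx thetaT thetaT_none thetaT_some
  thetaT_add dropFibre logT thetaT_eq_exp_logT thetaT_ne_zero thetaT_natMul yWeight prod_thetaT_pow orbitChar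
  orbitChar_ne_zero exp_yWeight_eq_of_orbitChar_eq charPerp mem_charPerp_iff charHom charHom_apply
  VanishesAlong vanishesAlong_one_iff sum_fin_add_choose idxEquiv)
open MvPolynomial Module

variable {β γ γ' δ : Type} [Fintype β] [Fintype γ] [Fintype γ'] [Fintype δ] [DecidableEq γ] [DecidableEq γ']
variable (L L' : PeriodPair) (κM : δ → γ ⊕ γ' → Kbar)

/-! ### Translations with vanishing `E`-coordinates -/

/-- The slope of `Θ_J` along a translation `v` with `z'(v) = 0`, at `w`:
`0` for `J = (a, (M, none))`, `s_e(v) · Θ_{(a,(M,none))}(w)` for `J = (a, (M, some e))`. [folklore] -/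
def slope (v w : β ⊕ ((γ ⊕ γ') ⊕ δ) → ℂ) (J : Option β × ThetaIdx (γ ⊕ γ') δ) : ℂ :=
  match J.2.2 with
  | none => 0
  | some e => v (is e) * theta L L' κM (dropFibre J) w

omit [Fintype β] [Fintype δ] [DecidableEq γ] [DecidableEq γ'] in
/-- `Θ^P_{(M,none)}` only sees `z'`. [folklore] -/
theorem thetaPnone_add_of_z (M : γ ⊕ γ' → Fin 3) {w v : β ⊕ ((γ ⊕ γ') ⊕ δ) → ℂ} (hv : ∀ b, v (iz b) = 0) :
    thetaPnone (β := β) (δ := δ) L L' M (w + v) = thetaPnone L L' M w := by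
  unfold thetaPnone
  simp [hv]

omit [Fintype β] [Fintype δ] in
/-- `Θ^P_{(M,some e)}` is affine in `s_e` with slope `Θ^P_{(M,none)}`. [folklore] -/
theorem thetaPsome_add_of_z (M : γ ⊕ γ' → Fin 3) (e : δ) {w v : β ⊕ ((γ ⊕ γ') ⊕ δ) → ℂ} (hv : ∀ b, v (iz b) = 0) :
    thetaPsome (β := β) L L' κM M e (w + v) = thetaPsome L L' κM M e w + v (is e) * thetaPnone L L' M w := by
  unfold thetaPsome
  rw [thetaPnone_add_of_z L L' M hv]
  simp only [Pi.add_apply, hv, add_zero]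
  ring

omit [Fintype β] [Fintype δ] in
/-- **Translation with `z' = 0`**: `Θ_J(w + v) = T_{J}(v) · (Θ_J(w) + slope_J(v, w))`. [folklore] -/
theorem theta_add_of_z (J : Option β × ThetaIdx (γ ⊕ γ') δ) {w v : β ⊕ ((γ ⊕ γ') ⊕ δ) → ℂ} (hv : ∀ b, v (iz b) = 0) :
    theta L L' κM J (w + v) = thetaT J.1 v * (theta L L' κM J w + slope L L' κM v w J) := by
  obtain ⟨a, M, _ | e⟩ := J
  · simp only [theta, thetaP_none, slope, add_zero]
    rw [thetaT_add, thetaPnone_add_of_z L L' M hv, mul_assoc]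
  · simp only [theta, thetaP_some, slope, dropFibre, thetaP_none]
    rw [thetaT_add, thetaPsome_add_of_z L L' κM M e hv]
    ring

omit [Fintype β] [Fintype δ] in
/-- Slopes are linear in the translation: `slope (c • v) = c · slope v`. [folklore] -/
theorem slope_smul (c : ℂ) (v w : β ⊕ ((γ ⊕ γ') ⊕ δ) → ℂ) (J : Option β × ThetaIdx (γ ⊕ γ') δ) :
    slope L L' κM (c • v) w J = c * slope L L' κM v w J := by
  obtain ⟨a, M, _ | e⟩ := J
  · simp [slope]
  · simp [slope, mul_assoc]

omit [Fintype β] [Fintype δ] in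
/-- Slopes only see the `s`-coordinates of the translation. [folklore] -/
theorem slope_congr (v v' : β ⊕ ((γ ⊕ γ') ⊕ δ) → ℂ) (h : ∀ e, v (is e) = v' (is e)) (w : β ⊕ ((γ ⊕ γ') ⊕ δ) → ℂ)
    (J : Option β × ThetaIdx (γ ⊕ γ') δ) : slope L L' κM v w J = slope L L' κM v' w J := by
  obtain ⟨a, M, _ | e⟩ := J
  · simp [slope]
  · simp [slope, h e]

/-! ### `F_P` along a `z'`-free translation: the exponential-polynomial structure -/

/-- The polynomial `Q_μ(X) = c_μ ∏_J (Θ_J(w) + X · slope_J(r, w))^{μ J}` attached to a monomial of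
`P`, a base point `w` and a `z'`-free translation `r`. [folklore] -/
def orbitPoly (P : MvPolynomial (Option β × ThetaIdx (γ ⊕ γ') δ) ℂ) (w r : β ⊕ ((γ ⊕ γ') ⊕ δ) → ℂ)
    (μ : (Option β × ThetaIdx (γ ⊕ γ') δ) →₀ ℕ) : Polynomial ℂ :=
  Polynomial.C (P.coeff μ) *
    ∏ J ∈ μ.support, (Polynomial.C (theta L L' κM J w) + Polynomial.X * Polynomial.C (slope L L' κM r w J)) ^ μ J

omit [Fintype β] [Fintype δ] in
/-- The degree of `Q_μ` is at most `|μ|`. [folklore] -/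
theorem natDegree_orbitPoly_le (P : MvPolynomial (Option β × ThetaIdx (γ ⊕ γ') δ) ℂ) (w r : β ⊕ ((γ ⊕ γ') ⊕ δ) → ℂ)
    (μ : (Option β × ThetaIdx (γ ⊕ γ') δ) →₀ ℕ) :
    (orbitPoly L L' κM P w r μ).natDegree ≤ μ.degree := by
  unfold orbitPoly
  refine (Polynomial.natDegree_C_mul_le _ _).trans ?_
  refine (Polynomial.natDegree_prod_le _ _).trans ?_
  rw [Finsupp.degree]
  refine Finset.sum_le_sum fun J _ => ?_
  refine (Polynomial.natDegree_pow_le).trans ?_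
  have : (Polynomial.C (theta L L' κM J w) + Polynomial.X * Polynomial.C (slope L L' κM r w J)).natDegree ≤ 1 := by
    refine (Polynomial.natDegree_add_le _ _).trans ?_
    rw [Polynomial.natDegree_C, Nat.zero_max]
    calc (Polynomial.X * Polynomial.C (slope L L' κM r w J)).natDegree
        ≤ Polynomial.X.natDegree + (Polynomial.C (slope L L' κM r w J)).natDegree :=
          Polynomial.natDegree_mul_le
      _ ≤ 1 := by rw [Polynomial.natDegree_C, add_zero]; exact Polynomial.natDegree_X_le
  calc μ J * (Polynomial.C (theta L L' κM J w) + Polynomial.X * Polynomial.C (slope L L' κM r w J)).natDegree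
      ≤ μ J * 1 := Nat.mul_le_mul_left _ this
    _ = μ J := mul_one _

omit [Fintype δ] in
/-- **`F_P` along a general `z'`-free translation**, monomial by monomial:
`F_P(w + v) = ∑_μ exp(∑_j m_μ(j) y'_j(v)) · Q_μ(τ)` whenever `s(v) = τ s(r)`. [folklore] -/
theorem thetaEval_add_of_z (P : MvPolynomial (Option β × ThetaIdx (γ ⊕ γ') δ) ℂ) (w r v : β ⊕ ((γ ⊕ γ') ⊕ δ) → ℂ)
    (hv : ∀ b, v (iz b) = 0) (τ : ℂ) (hs : ∀ e, v (is e) = τ * r (is e)) :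
    thetaEval L L' κM P (w + v) =
      ∑ μ ∈ P.support, cexp (∑ j, (yWeight μ j : ℂ) * v (iy j)) * (orbitPoly L L' κM P w r μ).eval τ := by
  classical
  rw [thetaEval, MvPolynomial.eval_eq]
  refine Finset.sum_congr rfl fun μ _ => ?_
  have hθ : ∀ J, theta L L' κM J (w + v) = thetaT J.1 v * (theta L L' κM J w + τ * slope L L' κM r w J) := by
    intro J
    rw [theta_add_of_z L L' κM J hv, slope_congr L L' κM v (τ • r) (fun e => by simp [hs e]) w J,
      slope_smul]
  simp only [hθ, mul_pow, Finset.prod_mul_distrib, prod_thetaT_pow]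
  rw [orbitPoly, Polynomial.eval_mul, Polynomial.eval_C, Polynomial.eval_prod]
  simp only [Polynomial.eval_pow, Polynomial.eval_add, Polynomial.eval_C, Polynomial.eval_mul,
    Polynomial.eval_X]
  ring

omit [Fintype δ] in
/-- **`F_P` along the orbit `w + ℕ r`** (`z'(r) = 0`) is an exponential polynomial:
`F_P(w + n r) = ∑_μ α_μ^n Q_μ(n)`. [folklore] -/
theorem thetaEval_add_natMul (P : MvPolynomial (Option β × ThetaIdx (γ ⊕ γ') δ) ℂ) (w r : β ⊕ ((γ ⊕ γ') ⊕ δ) → ℂ)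
    (hr : ∀ b, r (iz b) = 0) (n : ℕ) :
    thetaEval L L' κM P (w + (n : ℂ) • r) =
      ∑ μ ∈ P.support, orbitChar r μ ^ n * (orbitPoly L L' κM P w r μ).eval (n : ℂ) := by
  rw [thetaEval_add_of_z L L' κM P w r ((n : ℂ) • r) (fun b => by simp [hr b]) n (fun e => by simp)]
  refine Finset.sum_congr rfl fun μ _ => ?_
  congr 1
  rw [orbitChar, ← exp_nat_mul, Finset.mul_sum]
  congr 1
  refine Finset.sum_congr rfl fun j _ => ?_
  simp only [Pi.smul_apply, smul_eq_mul]
  ring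

/-! ### The periodicity (orbit-closure) lemma -/

omit [Fintype δ] in
/-- **Periodicity (orbit-closure) lemma.** Let `r ∈ V` have vanishing `E`-coordinates. If `F_P`
vanishes at `w + n r` for every `n ∈ ℕ`, then `F_P` vanishes at `w + (θ, 0, τ s(r))` for every
`τ ∈ ℂ` and every `θ ∈ ℂ^β` orthogonal to all `q ∈ ℤ^β` with `e^{⟨q, y'(r)⟩} = 1`: the Zariski
closure of the orbit `w + ℕ r` contains these translates (the connected algebraic hull of `r`
translated to `w`). Proof: `F_P(w + n r) = ∑_α α^n R_α(n)` with distinct non-zero `α` forces all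
`R_α = 0` (Baker's generalised Vandermonde lemma), and `F_P(w + (θ, 0, τ s(r))) = ∑_α e^{⟨m_α,θ⟩} R_α(τ)`.
[cite: BakerTNT1975, Ch. 3 §2 Lemma 3] -/
theorem thetaEval_eq_zero_of_forall_natMul (P : MvPolynomial (Option β × ThetaIdx (γ ⊕ γ') δ) ℂ)
    {w r : β ⊕ ((γ ⊕ γ') ⊕ δ) → ℂ} (hr : ∀ b, r (iz b) = 0)
    (h : ∀ n : ℕ, thetaEval L L' κM P (w + (n : ℂ) • r) = 0)
    {θ : β → ℂ} (hθ : ∀ q : β → ℤ, cexp (∑ j, (q j : ℂ) * r (iy j)) = 1 → ∑ j, (q j : ℂ) * θ j = 0)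
    (τ : ℂ) : thetaEval L L' κM P (w + coords θ 0 (fun e => τ * r (is e))) = 0 := by
  classical
  -- the distinct characters
  set S := P.support with hS
  set A := S.image (orbitChar (γ := γ ⊕ γ') (δ := δ) r) with hA
  -- the grouped polynomials `R_a = ∑_{α_μ = a} Q_μ`
  set R : ℂ → Polynomial ℂ := fun a => ∑ μ ∈ S with orbitChar (γ := γ ⊕ γ') (δ := δ) r μ = a,
    orbitPoly L L' κM P w r μ with hR
  -- Step 1: `∑_{a ∈ A} R_a(n) a^n = F_P(w + n r) = 0`
  have hsum : ∀ n : ℕ, ∑ a ∈ A, (R a).eval (n : ℂ) * a ^ n = 0 := by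
    intro n
    rw [← h n, thetaEval_add_natMul L L' κM P w r hr n, hA,
      ← Finset.sum_fiberwise_of_maps_to (s := S) (t := S.image (orbitChar r))
        (g := orbitChar (γ := γ ⊕ γ') (δ := δ) r) (fun μ hμ => Finset.mem_image_of_mem _ hμ)]
    refine Finset.sum_congr rfl fun a _ => ?_
    rw [hR]
    simp only [Polynomial.eval_finsetSum, Finset.sum_mul]
    refine Finset.sum_congr rfl fun μ hμ => ?_
    rw [Finset.mem_filter] at hμ
    rw [hμ.2, mul_comm]
  -- Step 2: all `R_a = 0` (generalised Vandermonde)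
  have hRzero : ∀ a ∈ A, R a = 0 := by
    set D := P.totalDegree + 1 with hD
    have hdeg : ∀ a : A, R a = 0 ∨ (R a).natDegree < D := by
      intro a
      right
      rw [hR]
      refine lt_of_le_of_lt (Polynomial.natDegree_sum_le_of_forall_le _ _ fun μ hμ => ?_)
        (Nat.lt_succ_self _)
      rw [Finset.mem_filter] at hμ
      exact (natDegree_orbitPoly_le L L' κM P w r μ).trans (MvPolynomial.le_totalDegree hμ.1)
    have hall := Baker1975.Ch3.ExpPoly.eq_zero_of_esum_eq_zero (A := A) (fun a => (a : ℂ))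
      Subtype.val_injective (fun a => by
        obtain ⟨a, ha⟩ := a
        rw [hA, Finset.mem_image] at ha
        obtain ⟨μ, _, rfl⟩ := ha
        exact orbitChar_ne_zero r μ) (fun a => R a) hdeg (fun i _ => by
        rw [← hsum i]
        exact (Finset.sum_coe_sort A (fun a => (R a).eval (i : ℂ) * a ^ i)))
    intro a ha
    exact hall ⟨a, ha⟩
  -- Step 3: `F_P(w + (θ, 0, τ s(r))) = ∑_a e^{⟨m_a, θ⟩} R_a(τ) = 0`
  rw [thetaEval_add_of_z L L' κM P w r (coords θ 0 fun e => τ * r (is e)) (fun b => by simp) τ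
    (fun e => by simp)]
  rw [← Finset.sum_fiberwise_of_maps_to (s := S) (t := A) (g := orbitChar (γ := γ ⊕ γ') (δ := δ) r)
    (fun μ hμ => Finset.mem_image_of_mem _ hμ)]
  refine Finset.sum_eq_zero fun a ha => ?_
  -- on the fibre of `a`, the `θ`-character is constant
  obtain ⟨μ₀, hμ₀S, hμ₀⟩ := Finset.mem_image.mp ha
  have hconst : ∀ μ ∈ S.filter (fun μ => orbitChar (γ := γ ⊕ γ') (δ := δ) r μ = a),
      cexp (∑ j, (yWeight μ j : ℂ) * (coords θ (0 : γ ⊕ γ' → ℂ) (fun e => τ * r (is e))) (iy j)) =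
        cexp (∑ j, (yWeight μ₀ j : ℂ) * θ j) := by
    intro μ hμ
    rw [Finset.mem_filter] at hμ
    simp only [coords_iy]
    exact exp_yWeight_eq_of_orbitChar_eq hθ (hμ.2.trans hμ₀.symm)
  calc ∑ μ ∈ S.filter (fun μ => orbitChar r μ = a),
        cexp (∑ j, (yWeight μ j : ℂ) * (coords θ (0 : γ ⊕ γ' → ℂ) (fun e => τ * r (is e))) (iy j)) *
          (orbitPoly L L' κM P w r μ).eval τ
      = ∑ μ ∈ S.filter (fun μ => orbitChar r μ = a),
          cexp (∑ j, (yWeight μ₀ j : ℂ) * θ j) * (orbitPoly L L' κM P w r μ).eval τ :=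
        Finset.sum_congr rfl fun μ hμ => by rw [hconst μ hμ]
    _ = cexp (∑ j, (yWeight μ₀ j : ℂ) * θ j) * (R a).eval τ := by
        rw [hR]; simp only [Polynomial.eval_finsetSum, Finset.mul_sum]
    _ = 0 := by rw [hRzero a ha]; simp

/-! ### Translations with lattice `E`-coordinates -/

omit [Fintype β] [Fintype δ] [DecidableEq γ] [DecidableEq γ'] in
/-- The kernel vector over a lattice vector `λ = (m_b ω₁ + n_b ω₂)_b`:
`(0; λ; (∑_b κ_{eb} η(λ_b))_e) ∈ ker(exp_{M_κ})`. [folklore] -/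
theorem coords_lattice_mem_ker (m n : γ ⊕ γ' → ℤ) :
    coords (0 : β → ℂ) (fun b => (m b : ℂ) * (lat L L' b).ω₁ + (n b : ℂ) * (lat L L' b).ω₂)
      (fun e => ∑ b, (κM e b : ℂ) * ((m b : ℂ) * (lat L L' b).η₁ + (n b : ℂ) * (lat L L' b).η₂)) ∈ ker L L' κM :=
  ⟨fun j => ⟨0, by simp⟩, m, n, fun b => by simp, fun e => by simp⟩

/-- For a FORM `P`, `F_P(x + k) = 0 ↔ F_P(x) = 0` for `k ∈ ker(exp_{M_κ})` (automorphy). [folklore] -/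
theorem thetaEval_add_ker_eq_zero_iff {P : MvPolynomial (Option β × ThetaIdx (γ ⊕ γ') δ) ℂ}
    {D : ℕ} (hP : P.IsHomogeneous D) {k : β ⊕ ((γ ⊕ γ') ⊕ δ) → ℂ} (hk : k ∈ ker L L' κM) (x : β ⊕ ((γ ⊕ γ') ⊕ δ) → ℂ) :
    thetaEval L L' κM P (x + k) = 0 ↔ thetaEval L L' κM P x = 0 := by
  rw [← vanishesAlong_one_iff ⊤ (thetaEval L L' κM P) (x + k), ← vanishesAlong_one_iff ⊤ (thetaEval L L' κM P) x]
  exact vanishesAlong_add_ker_iff L L' κM hP ⊤ hk x 1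

/-- **Periodicity lemma, lattice version.** Let `P` be a form vanishing on `X ⊆ V`, and `t ∈ V` a
translation with lattice `E`-coordinates `z'_b(t) = m_b ω₁ + n_b ω₂` such that the orbit `w + ℕ t`
stays in `X`. Then `F_P` vanishes at `w + (θ, 0, τ c)` for all `τ ∈ ℂ` and all `θ` orthogonal to
the integer relations `q` with `e^{⟨q, y'(t)⟩} = 1`, where `c = s(t) - (∑_b κ_{eb} η(z'_b(t)))_e`:
subtracting the kernel vector over `z'(t)` (automorphy of `Θ`, `GaGmE.Std.exists_theta_add_ker`)
reduces to `thetaEval_eq_zero_of_forall_natMul`. [folklore] -/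
theorem thetaEval_eq_zero_of_forall_natMul_lattice {P : MvPolynomial (Option β × ThetaIdx (γ ⊕ γ') δ) ℂ}
    {D : ℕ} (hP : P.IsHomogeneous D) {X : Set (β ⊕ ((γ ⊕ γ') ⊕ δ) → ℂ)}
    (hX : ∀ x ∈ X, thetaEval L L' κM P x = 0) {t : β ⊕ ((γ ⊕ γ') ⊕ δ) → ℂ} (m n : γ ⊕ γ' → ℤ)
    (ht : ∀ b, t (iz b) = (m b : ℂ) * (lat L L' b).ω₁ + (n b : ℂ) * (lat L L' b).ω₂) {w : β ⊕ ((γ ⊕ γ') ⊕ δ) → ℂ}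
    (hw : ∀ k : ℕ, w + (k : ℂ) • t ∈ X) {θ : β → ℂ}
    (hθ : ∀ q : β → ℤ, cexp (∑ j, (q j : ℂ) * t (iy j)) = 1 → ∑ j, (q j : ℂ) * θ j = 0) (τ : ℂ) :
    thetaEval L L' κM P (w + coords θ 0 (fun e =>
      τ * (t (is e) - ∑ b, (κM e b : ℂ) * ((m b : ℂ) * (lat L L' b).η₁ + (n b : ℂ) * (lat L L' b).η₂)))) = 0 := by
  set k₀ : β ⊕ ((γ ⊕ γ') ⊕ δ) → ℂ := coords (0 : β → ℂ) (fun b => (m b : ℂ) * (lat L L' b).ω₁ + (n b : ℂ) * (lat L L' b).ω₂)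
      (fun e => ∑ b, (κM e b : ℂ) * ((m b : ℂ) * (lat L L' b).η₁ + (n b : ℂ) * (lat L L' b).η₂)) with hk₀
  have hk₀mem : k₀ ∈ ker L L' κM := coords_lattice_mem_ker L L' κM m n
  set r := t - k₀ with hr
  have hrz : ∀ b, r (iz b) = 0 := fun b => by simp [hr, hk₀, ht b]
  have hry : ∀ j, r (iy j) = t (iy j) := fun j => by simp [hr, hk₀]
  have hrs : ∀ e, r (is e) = t (is e) - ∑ b, (κM e b : ℂ) * ((m b : ℂ) * (lat L L' b).η₁ + (n b : ℂ) * (lat L L' b).η₂) :=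
    fun e => by simp [hr, hk₀]
  -- the orbit along `r` is the orbit along `t` shifted by kernel vectors
  have horb : ∀ k : ℕ, thetaEval L L' κM P (w + (k : ℂ) • r) = 0 := by
    intro k
    have e : w + (k : ℂ) • t = (w + (k : ℂ) • r) + (k : ℂ) • k₀ := by
      rw [hr, smul_sub]; abel
    have := hX _ (hw k)
    rwa [e, thetaEval_add_ker_eq_zero_iff L L' κM hP (natCast_smul_mem_ker L L' κM hk₀mem k)] at this
  have := thetaEval_eq_zero_of_forall_natMul L L' κM P hrz horb (θ := θ)
    (fun q hq => hθ q (by simpa only [hry] using hq)) τ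
  simpa only [hrs] using this

/-! ### Pure torus translations: Artin's independence of characters -/

omit [Fintype δ] in
/-- **Artin move.** If `F_P` vanishes at `w + (g, 0, 0)` for all `g` in an additive subgroup
`Γ ≤ ℂ^β`, then it vanishes at `w + (θ, 0, 0)` for all `θ ∈ charPerp Γ`: on these translates
`F_P` is a linear combination of the characters `e^{⟨m_μ, ·⟩}` of `Γ`, distinct characters are
linearly independent (Dedekind–Artin), and characters equal on `Γ` are equal at `θ`.
[folklore] -/
theorem thetaEval_eq_zero_of_forall_mem_addSubgroup (P : MvPolynomial (Option β × ThetaIdx (γ ⊕ γ') δ) ℂ)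
    {w : β ⊕ ((γ ⊕ γ') ⊕ δ) → ℂ} (Γ : AddSubgroup (β → ℂ))
    (h : ∀ g ∈ Γ, thetaEval L L' κM P (w + coords g 0 0) = 0) {θ : β → ℂ} (hθ : θ ∈ charPerp Γ) :
    thetaEval L L' κM P (w + coords θ 0 0) = 0 := by
  classical
  -- `F_P(w + (g, 0, 0)) = ∑_μ e^{⟨m_μ, g⟩} c_μ`
  set c : ((Option β × ThetaIdx (γ ⊕ γ') δ) →₀ ℕ) → ℂ := fun μ => (orbitPoly L L' κM P w 0 μ).eval 0 with hc
  have hexp : ∀ g : β → ℂ, thetaEval L L' κM P (w + coords g 0 0) =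
      ∑ μ ∈ P.support, cexp (∑ j, (yWeight μ j : ℂ) * g j) * c μ := by
    intro g
    rw [thetaEval_add_of_z L L' κM P w 0 (coords g 0 0) (fun b => by simp) 0 (fun e => by simp)]
    simp only [coords_iy, hc]
  -- group the monomials by their character on `Γ`
  set S := P.support with hS
  set Φ : ((Option β × ThetaIdx (γ ⊕ γ') δ) →₀ ℕ) → (Multiplicative Γ →* ℂ) := fun μ => charHom Γ (yWeight μ)
    with hΦ
  set T := S.image Φ with hT
  set a : (Multiplicative Γ →* ℂ) → ℂ := fun f => ∑ μ ∈ S with Φ μ = f, c μ with ha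
  -- the linear combination `∑_{f ∈ T} a_f • f` vanishes on `Γ`
  have hcomb : ∑ f ∈ T, a f • (f : Multiplicative Γ → ℂ) = 0 := by
    funext x
    simp only [Finset.sum_apply, Pi.smul_apply, smul_eq_mul, Pi.zero_apply]
    have hx := h (x.toAdd : β → ℂ) (x.toAdd).2
    rw [hexp] at hx
    rw [← hx, ← Finset.sum_fiberwise_of_maps_to (s := S) (t := T) (g := Φ)
      (fun μ hμ => Finset.mem_image_of_mem _ hμ)]
    refine Finset.sum_congr rfl fun f hf => ?_
    rw [ha, Finset.sum_mul]
    refine Finset.sum_congr rfl fun μ hμ => ?_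
    rw [Finset.mem_filter] at hμ
    rw [← hμ.2, hΦ, charHom_apply, mul_comm]
  have hzero : ∀ f ∈ T, a f = 0 :=
    linearIndependent_iff'.mp (linearIndependent_monoidHom (Multiplicative Γ) ℂ) T a hcomb
  -- evaluate at `θ`
  rw [hexp, ← Finset.sum_fiberwise_of_maps_to (s := S) (t := T) (g := Φ)
    (fun μ hμ => Finset.mem_image_of_mem _ hμ)]
  refine Finset.sum_eq_zero fun f hf => ?_
  obtain ⟨μ₀, hμ₀S, hμ₀⟩ := Finset.mem_image.mp hf
  have hconst : ∀ μ ∈ S.filter (fun μ => Φ μ = f),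
      cexp (∑ j, (yWeight μ j : ℂ) * θ j) = cexp (∑ j, (yWeight μ₀ j : ℂ) * θ j) := by
    intro μ hμ
    rw [Finset.mem_filter] at hμ
    have hΦeq : Φ μ = Φ μ₀ := hμ.2.trans hμ₀.symm
    -- the integer relation `m_μ - m_μ₀` is trivial on `Γ`, hence orthogonal to `θ`
    have hq := (mem_charPerp_iff.mp hθ) (fun j => (yWeight μ j : ℤ) - (yWeight μ₀ j : ℤ)) (by
      intro g hg
      have := congrArg (fun F : Multiplicative Γ →* ℂ => F (Multiplicative.ofAdd ⟨g, hg⟩)) hΦeq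
      simp only [hΦ, charHom_apply, toAdd_ofAdd] at this
      have e : ∑ j, (((yWeight μ j : ℤ) - (yWeight μ₀ j : ℤ) : ℤ) : ℂ) * g j =
          ∑ j, (yWeight μ j : ℂ) * g j - ∑ j, (yWeight μ₀ j : ℂ) * g j := by
        rw [← Finset.sum_sub_distrib]
        refine Finset.sum_congr rfl fun j _ => ?_
        push_cast; ring
      rw [e, exp_sub, div_eq_one_iff_eq (exp_ne_zero _)]
      exact this)
    have e : ∑ j, (((yWeight μ j : ℤ) - (yWeight μ₀ j : ℤ) : ℤ) : ℂ) * θ j =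
        ∑ j, (yWeight μ j : ℂ) * θ j - ∑ j, (yWeight μ₀ j : ℂ) * θ j := by
      rw [← Finset.sum_sub_distrib]
      refine Finset.sum_congr rfl fun j _ => ?_
      push_cast; ring
    rw [e, sub_eq_zero] at hq
    rw [hq]
  calc ∑ μ ∈ S.filter (fun μ => Φ μ = f), cexp (∑ j, (yWeight μ j : ℂ) * θ j) * c μ
      = ∑ μ ∈ S.filter (fun μ => Φ μ = f), cexp (∑ j, (yWeight μ₀ j : ℂ) * θ j) * c μ :=
        Finset.sum_congr rfl fun μ hμ => by rw [hconst μ hμ]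
    _ = cexp (∑ j, (yWeight μ₀ j : ℂ) * θ j) * a f := by rw [ha, Finset.mul_sum]
    _ = 0 := by rw [hzero f hf, mul_zero]



/-! ### Theta models: the dictionary `M.F ↔ thetaEval` -/

section Model

variable {N : ℕ} (M : AnalyticGroupModel (β ⊕ ((γ ⊕ γ') ⊕ δ) → ℂ) N) (e : Option β × ThetaIdx (γ ⊕ γ') δ ≃ Fin (N + 1))

attribute [local instance] MvPolynomial.gradedAlgebra


variable (hΘ : ∀ J w, M.Θ (e J) w = theta L L' κM J w)
include hΘ

/-- `F_{P ∘ e}(w) = F_P(w)` in the notation of `thetaEval`. [folklore] -/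
theorem F_rename (P : MvPolynomial (Option β × ThetaIdx (γ ⊕ γ') δ) ℂ) (w : β ⊕ ((γ ⊕ γ') ⊕ δ) → ℂ) :
    M.F (rename e P) w = thetaEval L L' κM P w := by
  rw [AnalyticGroupModel.F_apply, eval_rename]
  unfold thetaEval
  congr 2
  funext J
  exact hΘ J w

/-- `M.F P = F_{P ∘ e⁻¹}`. [folklore] -/
theorem F_eq_thetaEval (P : MvPolynomial (Fin (N + 1)) ℂ) (w : β ⊕ ((γ ⊕ γ') ⊕ δ) → ℂ) :
    M.F P w = thetaEval L L' κM (rename e.symm P) w := by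
  rw [← F_rename L L' κM M e hΘ, rename_rename, e.self_comp_symm, rename_id, AlgHom.id_apply]

/-- A form vanishing on `X` (through `thetaEval`) vanishes on the closure `Z(𝔍(X))`. [folklore] -/
theorem thetaEval_eq_zero_of_mem_zeroSet {X : Set (β ⊕ ((γ ⊕ γ') ⊕ δ) → ℂ)}
    {P : MvPolynomial (Option β × ThetaIdx (γ ⊕ γ') δ) ℂ} {D : ℕ} (hP : P.IsHomogeneous D)
    (h : ∀ x ∈ X, thetaEval L L' κM P x = 0) {w : β ⊕ ((γ ⊕ γ') ⊕ δ) → ℂ}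
    (hw : w ∈ M.zeroSet ((M.vanishing X : Ideal _) : Set (MvPolynomial (Fin (N + 1)) ℂ))) :
    thetaEval L L' κM P w = 0 := by
  have hmem : rename e P ∈ M.vanishing X := by
    rw [M.mem_vanishing_iff_of_isHomogeneous hP.rename_isHomogeneous]
    intro x hx
    rw [F_rename L L' κM M e hΘ]
    exact h x hx
  have := M.F_eq_zero_of_mem_of_mem_zeroSet hmem hw
  rwa [F_rename L L' κM M e hΘ] at this

/-- **Closedness through `thetaEval`**: a point at which every form vanishing on the closed set
`X` vanishes lies in `X`. [folklore] -/
theorem mem_of_isClosedG {X : Set (β ⊕ ((γ ⊕ γ') ⊕ δ) → ℂ)} (hX : M.IsClosedG X) {w : β ⊕ ((γ ⊕ γ') ⊕ δ) → ℂ}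
    (h : ∀ (D : ℕ) (P : MvPolynomial (Option β × ThetaIdx (γ ⊕ γ') δ) ℂ), P.IsHomogeneous D →
      (∀ x ∈ X, thetaEval L L' κM P x = 0) → thetaEval L L' κM P w = 0) : w ∈ X := by
  rw [← hX.eq, M.mem_zeroSet_iff_forall_isHomogeneous (M.isHomogeneous_vanishing X)]
  intro P hP d hd
  rw [F_eq_thetaEval L L' κM M e hΘ]
  refine h d _ hd.rename_isHomogeneous fun x hx => ?_
  rw [← F_eq_thetaEval L L' κM M e hΘ]
  exact (M.mem_vanishing_iff_of_isHomogeneous hd).mp hP x hx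

/-- A closed set is a union of fibres of `exp_{M_κ}` (automorphy of `Θ` under the kernel). [folklore] -/
theorem add_mem_of_isClosedG_of_mem_ker {X : Set (β ⊕ ((γ ⊕ γ') ⊕ δ) → ℂ)} (hX : M.IsClosedG X)
    {x : β ⊕ ((γ ⊕ γ') ⊕ δ) → ℂ} (hx : x ∈ X) {k : β ⊕ ((γ ⊕ γ') ⊕ δ) → ℂ} (hk : k ∈ ker L L' κM) : x + k ∈ X :=
  mem_of_isClosedG L L' κM M e hΘ hX fun _ _ hP hvan =>
    (thetaEval_add_ker_eq_zero_iff L L' κM hP hk x).mpr (hvan x hx)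

/-! ### Step B1: the Hilbert function of the ideal of `Lie G'` -/

/-- **`H(𝔍(Lie G'); t) ≥ binom(t + dim G' + 1, dim G' + 1)`** (cumulative Hilbert function of the
ideal of the cone over `Lie G'`, `G'` any connected algebraic subgroup datum `K`): the
`binom(d + m, m)` degree-`d` forms of `PkappaThetaCosetHilbert.lean` for all `d ≤ t` are linearly
independent modulo `𝔍(Lie G')` (on the cone the variable `c` separates the degrees).
[cite: NesterenkoPhilippon2001, Ch. 11 Prop. 2.3, Thm. 4.1 (ℋ(H₀; D) ≥ D^{dim H₀})] -/
theorem choose_le_hilbC_vanishing_tangent (K : GaGmE.Std.SubgroupDataC β (γ ⊕ γ') δ κM) (t : ℕ) :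
    (t + finrank ℂ K.tangent + 1).choose (finrank ℂ K.tangent + 1) ≤
      ZeroEst.hilbC ((M.vanishing (K.tangent : Set (β ⊕ ((γ ⊕ γ') ⊕ δ) → ℂ))).restrictScalars ℂ) t := by
  classical
  set m := finrank ℂ K.tangent with hm
  set T := K.tangent with hT
  -- the families in each degree `d ≤ t`
  have hfam := fun d : Fin (t + 1) => exists_linearIndependent_thetaEval_coset L L' K 0 (d : ℕ) (κM := κM)
  choose n P hn hhom hli using hfam
  -- the evaluation map on the cone over `Lie G'`
  let Ψ : ZeroEst.Fil (N := N) t →ₗ[ℂ] (ℂ × T → ℂ) :=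
    { toFun := fun Q p => eval (p.1 • M.pt (p.2 : β ⊕ ((γ ⊕ γ') ⊕ δ) → ℂ)) (Q : MvPolynomial (Fin (N + 1)) ℂ)
      map_add' := fun Q Q' => by funext p; simp
      map_smul' := fun c Q => by funext p; simp [smul_eval] }
  have hΨapply : ∀ (Q : ZeroEst.Fil (N := N) t) (p : ℂ × T),
      Ψ Q p = eval (p.1 • M.pt (p.2 : β ⊕ ((γ ⊕ γ') ⊕ δ) → ℂ)) (Q : MvPolynomial (Fin (N + 1)) ℂ) := fun _ _ => rfl
  -- its kernel is `Fil t ∩ 𝔍(Lie G')`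
  have hker : LinearMap.ker Ψ =
      ((M.vanishing (T : Set (β ⊕ ((γ ⊕ γ') ⊕ δ) → ℂ))).restrictScalars ℂ).comap (ZeroEst.Fil (N := N) t).subtype := by
    ext Q
    simp only [LinearMap.mem_ker, Submodule.mem_comap, Submodule.coe_subtype, Submodule.restrictScalars_mem]
    rw [M.mem_vanishing_iff]
    constructor
    · intro h w hw c
      have := congr_fun h (c, ⟨w, hw⟩)
      rwa [hΨapply] at this
    · intro h
      funext p
      rw [hΨapply]
      exact h _ p.2.2 p.1
  have hkerdim : finrank ℂ (LinearMap.ker Ψ) =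
      finrank ℂ ↥(ZeroEst.Fil (N := N) t ⊓ (M.vanishing (T : Set (β ⊕ ((γ ⊕ γ') ⊕ δ) → ℂ))).restrictScalars ℂ) := by
    rw [hker]
    have e1 : Submodule.comap (ZeroEst.Fil (N := N) t).subtype
        ((M.vanishing (T : Set (β ⊕ ((γ ⊕ γ') ⊕ δ) → ℂ))).restrictScalars ℂ) =
        Submodule.comap (ZeroEst.Fil (N := N) t).subtype
          (ZeroEst.Fil t ⊓ (M.vanishing (T : Set (β ⊕ ((γ ⊕ γ') ⊕ δ) → ℂ))).restrictScalars ℂ) := by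
      rw [Submodule.comap_inf, Submodule.comap_subtype_self, top_inf_eq]
    rw [e1]
    exact (Submodule.comapSubtypeEquivOfLe inf_le_left).finrank_eq
  have hH : ZeroEst.hilbC ((M.vanishing (T : Set (β ⊕ ((γ ⊕ γ') ⊕ δ) → ℂ))).restrictScalars ℂ) t =
      finrank ℂ (LinearMap.range Ψ) := by
    have h1 := ZeroEst.hilbC_add_finrank_inf (N := N) ((M.vanishing (T : Set (β ⊕ ((γ ⊕ γ') ⊕ δ) → ℂ))).restrictScalars ℂ) t
    have h2 := LinearMap.finrank_range_add_finrank_ker Ψ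
    omega
  rw [hH]
  -- the combined family
  have hmemFil : ∀ i : (Σ d : Fin (t + 1), Fin (n d)), rename e (P i.1 i.2) ∈ ZeroEst.Fil (N := N) t := fun i =>
    ZeroEst.mem_Fil.mpr (((hhom i.1 i.2).rename_isHomogeneous.totalDegree_le).trans (Nat.lt_succ_iff.mp i.1.2))
  let f : (Σ d : Fin (t + 1), Fin (n d)) → ZeroEst.Fil (N := N) t := fun i => ⟨rename e (P i.1 i.2), hmemFil i⟩
  have hΨf : ∀ (i : Σ d : Fin (t + 1), Fin (n d)) (p : ℂ × T),
      Ψ (f i) p = p.1 ^ (i.1 : ℕ) * thetaEval L L' κM (P i.1 i.2) (p.2 : β ⊕ ((γ ⊕ γ') ⊕ δ) → ℂ) := by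
    intro i p
    rw [hΨapply]
    show eval (p.1 • M.pt (p.2 : β ⊕ ((γ ⊕ γ') ⊕ δ) → ℂ)) (rename e (P i.1 i.2)) = _
    rw [M.eval_smul_pt (hhom i.1 i.2).rename_isHomogeneous, F_rename L L' κM M e hΘ]
  have hliΨ : LinearIndependent ℂ fun i : (Σ d : Fin (t + 1), Fin (n d)) => Ψ (f i) := by
    rw [Fintype.linearIndependent_iff]
    intro a ha
    have hcw : ∀ (w : T) (c : ℂ), ∑ d : Fin (t + 1), c ^ (d : ℕ) *
        ∑ k : Fin (n d), a ⟨d, k⟩ * thetaEval L L' κM (P d k) (w : β ⊕ ((γ ⊕ γ') ⊕ δ) → ℂ) = 0 := by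
      intro w c
      have := congr_fun ha (c, w)
      simp only [Finset.sum_apply, Pi.smul_apply, smul_eq_mul, Pi.zero_apply] at this
      rw [← this, ← Finset.univ_sigma_univ, Finset.sum_sigma]
      refine Finset.sum_congr rfl fun d _ => ?_
      rw [Finset.mul_sum]
      refine Finset.sum_congr rfl fun k _ => ?_
      rw [hΨf]; ring
    have hcoef : ∀ (w : T) (d : Fin (t + 1)),
        ∑ k : Fin (n d), a ⟨d, k⟩ * thetaEval L L' κM (P d k) (w : β ⊕ ((γ ⊕ γ') ⊕ δ) → ℂ) = 0 := by
      intro w d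
      set q : Polynomial ℂ := ∑ d : Fin (t + 1), Polynomial.monomial (d : ℕ)
        (∑ k : Fin (n d), a ⟨d, k⟩ * thetaEval L L' κM (P d k) (w : β ⊕ ((γ ⊕ γ') ⊕ δ) → ℂ)) with hq
      have hqeval : ∀ c : ℂ, q.eval c = 0 := by
        intro c
        rw [hq, Polynomial.eval_finsetSum, ← hcw w c]
        refine Finset.sum_congr rfl fun d _ => ?_
        rw [Polynomial.eval_monomial]; ring
      have hq0 : q = 0 := Polynomial.funext fun c => by rw [hqeval c, Polynomial.eval_zero]
      have hc : q.coeff d = 0 := by rw [hq0, Polynomial.coeff_zero]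
      rw [hq, Polynomial.finsetSum_coeff, Finset.sum_eq_single d] at hc
      · simpa [Polynomial.coeff_monomial] using hc
      · intro d' _ hd'
        rw [Polynomial.coeff_monomial, if_neg]
        exact fun h => hd' (Fin.ext h)
      · intro h; exact absurd (Finset.mem_univ d) h
    rintro ⟨d, k⟩
    refine Fintype.linearIndependent_iff.mp (hli d) (fun k => a ⟨d, k⟩) ?_ k
    funext w
    simp only [Finset.sum_apply, Pi.smul_apply, smul_eq_mul, zero_add, Pi.zero_apply]
    exact hcoef w d
  have hli' : LinearIndependent ℂ fun i : (Σ d : Fin (t + 1), Fin (n d)) =>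
      (⟨Ψ (f i), LinearMap.mem_range_self Ψ (f i)⟩ : LinearMap.range Ψ) :=
    LinearIndependent.of_comp (LinearMap.range Ψ).subtype hliΨ
  have hcard := hli'.fintype_card_le_finrank
  rw [Fintype.card_sigma] at hcard
  simp only [Fintype.card_fin] at hcard
  have hsum : ∑ d : Fin (t + 1), n d = (t + m + 1).choose (m + 1) := by
    rw [Finset.sum_congr rfl fun d _ => hn d]
    exact sum_fin_add_choose t m
  rw [hsum] at hcard
  exact hcard

/-- **`coneDim (Lie G') ≥ dim G' + 1`** in any theta model. [folklore] -/
theorem finrank_tangent_succ_le_coneDim (K : GaGmE.Std.SubgroupDataC β (γ ⊕ γ') δ κM) :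
    finrank ℂ K.tangent + 1 ≤ M.coneDim (K.tangent : Set (β ⊕ ((γ ⊕ γ') ⊕ δ) → ℂ)) := by
  haveI := M.isPrime_vanishing_submodule K.tangent
  set d := M.coneDim (K.tangent : Set (β ⊕ ((γ ⊕ γ') ⊕ δ) → ℂ)) with hd
  have hdim : ringKrullDim (MvPolynomial (Fin (N + 1)) ℂ ⧸ M.vanishing (K.tangent : Set (β ⊕ ((γ ⊕ γ') ⊕ δ) → ℂ))) = d :=
    (M.coneDim_eq ⟨0, K.tangent.zero_mem⟩).symm
  obtain ⟨ρ, a, γ₂, -, hs⟩ := ZeroEst.exists_sandwich_of_isPrime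
    (𝔭 := M.vanishing (K.tangent : Set (β ⊕ ((γ ⊕ γ') ⊕ δ) → ℂ))) hdim
  refine AnalyticGroupModel.exponent_le_of_choose_le (ρ₁ := 1) (a₁ := 0) (K := 1) (ρ₂ := ρ) (c := 1)
    (γ₂ := γ₂) (t₀ := a) le_rfl fun t ht => ?_
  rw [one_mul, one_mul, one_mul, Nat.sub_zero]
  calc (t + (finrank ℂ K.tangent + 1)).choose (finrank ℂ K.tangent + 1)
      = (t + finrank ℂ K.tangent + 1).choose (finrank ℂ K.tangent + 1) := by rw [add_assoc]
    _ ≤ ZeroEst.hilbC ((M.vanishing (K.tangent : Set (β ⊕ ((γ ⊕ γ') ⊕ δ) → ℂ))).restrictScalars ℂ) t :=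
        choose_le_hilbC_vanishing_tangent L L' κM M e hΘ K t
    _ ≤ ρ * (t + γ₂ + d).choose d := (hs t ht).2




/-- `ker(exp) ⊆ H` for a closed subgroup `H`. [folklore] -/
theorem ker_subset_of_isClosedG {H : AddSubgroup (β ⊕ ((γ ⊕ γ') ⊕ δ) → ℂ)}
    (hH : M.IsClosedG (H : Set (β ⊕ ((γ ⊕ γ') ⊕ δ) → ℂ))) : ker L L' κM ⊆ (H : Set (β ⊕ ((γ ⊕ γ') ⊕ δ) → ℂ)) := by
  intro k hk
  have := add_mem_of_isClosedG_of_mem_ker L L' κM M e hΘ hH H.zero_mem hk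
  rwa [zero_add] at this

/-! ### Assembly: the classification from a hull theorem -/

/-- **Classification of the `Θ`-closed irreducible subgroups of `Lie M_ℂ` from a hull theorem.**
Given, for every complex subspace `𝔥`, a datum `hull 𝔥` with `𝔥 ≤ Lie(hull 𝔥)` such that
(`hHull`) every form vanishing on `𝔥` vanishes on `Lie(hull 𝔥)` and (`hB3`) every point at which
all forms vanishing on `𝔥` vanish lies in `exp⁻¹(hull 𝔥) = Lie(hull 𝔥) + ker`, a closed
irreducible additive subgroup `H` is `exp⁻¹(hull 𝒯(H))`, `Lie(hull 𝒯(H)) = 𝒯(H)` and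
`dim 𝒯(H) + 1 ≤ coneDim H` (Steps A, B0–B2 of the one-factor file, verbatim).
[cite: NesterenkoPhilippon2001, Ch. 11 Thm. 4.1 (H₀ = T_e⁻¹(H))] -/
theorem classification_of_hull
    (hull : Submodule ℂ (β ⊕ ((γ ⊕ γ') ⊕ δ) → ℂ) → SubgroupDataC β γ γ' δ κM)
    (le_hull : ∀ 𝔥, 𝔥 ≤ (hull 𝔥).tangent)
    (hHull : ∀ (𝔥 : Submodule ℂ (β ⊕ ((γ ⊕ γ') ⊕ δ) → ℂ)) (P : MvPolynomial (Option β × ThetaIdx (γ ⊕ γ') δ) ℂ)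
      (D : ℕ), P.IsHomogeneous D → (∀ x ∈ 𝔥, thetaEval L L' κM P x = 0) →
      ∀ w ∈ (hull 𝔥).tangent, thetaEval L L' κM P w = 0)
    (hB3 : ∀ (𝔥 : Submodule ℂ (β ⊕ ((γ ⊕ γ') ⊕ δ) → ℂ)) (w : β ⊕ ((γ ⊕ γ') ⊕ δ) → ℂ),
      (∀ (D : ℕ) (P : MvPolynomial (Option β × ThetaIdx (γ ⊕ γ') δ) ℂ), P.IsHomogeneous D →
        (∀ x ∈ 𝔥, thetaEval L L' κM P x = 0) → thetaEval L L' κM P w = 0) →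
      w ∈ preimageSubgroup L L' κM (hull 𝔥))
    {H : AddSubgroup (β ⊕ ((γ ⊕ γ') ⊕ δ) → ℂ)} (hH : M.IsIrred (H : Set (β ⊕ ((γ ⊕ γ') ⊕ δ) → ℂ))) :
    (preimageSubgroup L L' κM (hull (AnalyticGroupModel.linSpace (H : Set (β ⊕ ((γ ⊕ γ') ⊕ δ) → ℂ)))) :
        Set (β ⊕ ((γ ⊕ γ') ⊕ δ) → ℂ)) = H ∧
      AnalyticGroupModel.linSpace ((H : AddSubgroup _) : Set (β ⊕ ((γ ⊕ γ') ⊕ δ) → ℂ)) =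
        (hull (AnalyticGroupModel.linSpace (H : Set (β ⊕ ((γ ⊕ γ') ⊕ δ) → ℂ)))).tangent ∧
      finrank ℂ (hull (AnalyticGroupModel.linSpace (H : Set (β ⊕ ((γ ⊕ γ') ⊕ δ) → ℂ)))).tangent + 1 ≤
        M.coneDim ((H : AddSubgroup _) : Set (β ⊕ ((γ ⊕ γ') ⊕ δ) → ℂ)) := by
  set 𝔥 := AnalyticGroupModel.linSpace (H : Set (β ⊕ ((γ ⊕ γ') ⊕ δ) → ℂ)) with h𝔥
  have hcl := hH.isClosedG
  -- Step A: `Lie(hull 𝔥) ⊆ H`, hence `= 𝔥`; `ker ⊆ H`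
  have hTH : ((hull 𝔥).tangent : Set (β ⊕ ((γ ⊕ γ') ⊕ δ) → ℂ)) ⊆ H := fun w hw =>
    mem_of_isClosedG L L' κM M e hΘ hcl fun D P hP hvan =>
      hHull 𝔥 P D hP (fun x hx => hvan x (AnalyticGroupModel.linSpace_subset H hx)) w hw
  have hT : (hull 𝔥).tangent = 𝔥 :=
    le_antisymm (AnalyticGroupModel.le_linSpace_of_subset hTH) (le_hull 𝔥)
  have hpre : preimageSubgroup L L' κM (hull 𝔥) ≤ H := by
    refine sup_le (fun w hw => hTH hw) ?_
    rw [AddSubgroup.closure_le]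
    exact ker_subset_of_isClosedG L L' κM M e hΘ hcl
  -- Step B1/B2: the closure `Y = Z(𝔍(𝔥))` of the lineality space is all of `H`
  set Y := M.zeroSet ((M.vanishing (𝔥 : Set (β ⊕ ((γ ⊕ γ') ⊕ δ) → ℂ)) : Ideal _) :
    Set (MvPolynomial (Fin (N + 1)) ℂ)) with hY
  have hYcl : M.IsClosedG Y := M.isClosedG_zeroSet _
  have h0Y : (0 : β ⊕ ((γ ⊕ γ') ⊕ δ) → ℂ) ∈ Y := M.subset_zeroSet_vanishing _ 𝔥.zero_mem
  have hYH : Y ⊆ H := by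
    rw [← hcl.eq]
    exact M.zeroSet_antitone (M.vanishing_antitone (AnalyticGroupModel.linSpace_subset H))
  have hdimT : finrank ℂ (hull 𝔥).tangent + 1 ≤ M.coneDim ((hull 𝔥).tangent : Set (β ⊕ ((γ ⊕ γ') ⊕ δ) → ℂ)) :=
    finrank_tangent_succ_le_coneDim L L' κM M e hΘ (hull 𝔥).toOne
  have hdim𝔥 : finrank ℂ 𝔥 + 1 ≤ M.coneDim Y := by
    rw [hY, M.coneDim_zeroSet_vanishing]
    rwa [hT] at hdimT
  have hdimH : M.coneDim (H : Set (β ⊕ ((γ ⊕ γ') ⊕ δ) → ℂ)) ≤ finrank ℂ 𝔥 + 1 :=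
    M.coneDim_le_finrank_linSpace_succ H hH
  have hYeq : Y = H := hH.eq_of_subset_of_coneDim_eq M hYcl ⟨0, h0Y⟩ hYH (hdimH.trans hdim𝔥)
  refine ⟨Set.Subset.antisymm (fun w hw => hpre hw) fun w hw => ?_, hT.symm, ?_⟩
  · -- Step B3
    rw [← hYeq] at hw
    exact hB3 𝔥 w fun D P hP hvan => thetaEval_eq_zero_of_mem_zeroSet L L' κM M e hΘ hP hvan hw
  · rw [hT]
    calc finrank ℂ 𝔥 + 1 ≤ M.coneDim Y := hdim𝔥
      _ ≤ M.coneDim (H : Set (β ⊕ ((γ ⊕ γ') ⊕ δ) → ℂ)) := M.coneDim_mono hYH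

end Model

/-! ### The theta model of `TwoCurveThetaModel.lean`: the zero estimate from a hull theorem -/

/-- The coordinates of the theta model are the theta functions (up to the indexing `idxEquiv`).
[folklore] -/
theorem Θ_thetaModel_symm (H : HardData (β := β) L L' κM) (J : Option β × ThetaIdx (γ ⊕ γ') δ)
    (w : β ⊕ ((γ ⊕ γ') ⊕ δ) → ℂ) :
    (thetaModel L L' κM H).Θ ((idxEquiv β (γ ⊕ γ') δ).symm J) w = theta L L' κM J w := by
  show Θf L L' κM ((idxEquiv β (γ ⊕ γ') δ).symm J) w = theta L L' κM J w
  rw [Θf, Equiv.apply_symm_apply]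

/-- **Philippon's zero estimate (1986, Thm. 2.1) for the two-lattice theta model from a hull
theorem**: the body of the two-lattice twin of `philippon1986_std` at `(L, L', β, γ, γ', δ, κ)`,
granted a hull map `hull` with `𝔥 ≤ Lie(hull 𝔥)`, the hull property `hHull` (forms vanishing on
`𝔥` vanish on `Lie(hull 𝔥)`) and the closure property `hB3` (`Z(𝔍(𝔥)) ⊆ exp⁻¹(hull 𝔥)`) — the
hard geometric data of the embedding being PROVED (`TwoCurveThetaModel.hardData`).
[cite: Philippon1986, Thm 2.1] [cite: NesterenkoPhilippon2001, Ch. 11 Thm. 4.1] -/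
theorem philippon_of_hull [DecidableEq β] [DecidableEq δ]
    (hull : Submodule ℂ (β ⊕ ((γ ⊕ γ') ⊕ δ) → ℂ) → SubgroupDataC β γ γ' δ κM)
    (le_hull : ∀ 𝔥, 𝔥 ≤ (hull 𝔥).tangent)
    (hHull : ∀ (𝔥 : Submodule ℂ (β ⊕ ((γ ⊕ γ') ⊕ δ) → ℂ)) (P : MvPolynomial (Option β × ThetaIdx (γ ⊕ γ') δ) ℂ)
      (D : ℕ), P.IsHomogeneous D → (∀ x ∈ 𝔥, thetaEval L L' κM P x = 0) →
      ∀ w ∈ (hull 𝔥).tangent, thetaEval L L' κM P w = 0)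
    (hB3 : ∀ (𝔥 : Submodule ℂ (β ⊕ ((γ ⊕ γ') ⊕ δ) → ℂ)) (w : β ⊕ ((γ ⊕ γ') ⊕ δ) → ℂ),
      (∀ (D : ℕ) (P : MvPolynomial (Option β × ThetaIdx (γ ⊕ γ') δ) ℂ), P.IsHomogeneous D →
        (∀ x ∈ 𝔥, thetaEval L L' κM P x = 0) → thetaEval L L' κM P w = 0) →
      w ∈ preimageSubgroup L L' κM (hull 𝔥)) :
    ∃ c : ℝ, 0 < c ∧ ∀ (𝔟 : Submodule ℂ (β ⊕ ((γ ⊕ γ') ⊕ δ) → ℂ)) (v : β ⊕ ((γ ⊕ γ') ⊕ δ) → ℂ)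
        (P : MvPolynomial (Option β × ThetaIdx (γ ⊕ γ') δ) ℂ) (D S T : ℕ),
        0 < Module.finrank ℂ 𝔟 → 1 ≤ D → 1 ≤ S → P.IsHomogeneous D → (∃ w, thetaEval L L' κM P w ≠ 0) →
        (∀ s : ℕ, s ≤ Fintype.card (β ⊕ ((γ ⊕ γ') ⊕ δ)) * S →
          VanishesAlong 𝔟 (thetaEval L L' κM P) ((s : ℂ) • v) (Fintype.card (β ⊕ ((γ ⊕ γ') ⊕ δ)) * T + 1)) →
        ∃ K : SubgroupDataC β γ γ' δ κM,
          (∃ w₀, ∀ w ∈ K.tangent, thetaEval L L' κM P (w₀ + w) = 0) ∧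
          (Nat.choose (T + (Module.finrank ℂ 𝔟 - Module.finrank ℂ ↥(𝔟 ⊓ K.tangent)))
              (Module.finrank ℂ 𝔟 - Module.finrank ℂ ↥(𝔟 ⊓ K.tangent)) : ℝ) *
            (orbitCard L L' κM K v S : ℝ) * (D : ℝ) ^ Module.finrank ℂ K.tangent ≤
            c * (D : ℝ) ^ Fintype.card (β ⊕ ((γ ⊕ γ') ⊕ δ)) :=
  philippon_shape_of_classification' L L' κM fun H₀ hirr =>
    ⟨hull (AnalyticGroupModel.linSpace ((H₀ : AddSubgroup _) : Set (β ⊕ ((γ ⊕ γ') ⊕ δ) → ℂ))),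
      classification_of_hull L L' κM (thetaModel L L' κM (hardData L L' κM)) (idxEquiv β (γ ⊕ γ') δ).symm
        (Θ_thetaModel_symm L L' κM (hardData L L' κM)) hull le_hull hHull hB3 hirr⟩

end Std

end GaGmEE

end Literature.NumberTheory.Transcendental

end
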